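import Summits.QuantumFields.YangMills.Theorems.SwapVirialDeficitBlowUpGnomonicFibreCoercivity
import HarnessLib

/-!
# THE NEGATIVE `z`-HEMISPHERE IS LARGE FIELD: `ε_z = false ⟹ 1/(900·L⁶) ≤ F̂(a, ε, η)` for every hub `a ≠ 0` and ALL gnomonic coordinates
# (principal sector; free-hands support of ⟨stmt-QuantumFields-24197⟩ `SwapVirialDeficit.SwapGluedStiffness`)

Companion of w3 g65's ✓`gnoDeficit_one_ge_of_follower_sign_false` («non-plus FOLLOWER patterns are large field») for the third leader letter: in the gnomonic
ring integral `Ẑ = K_L ∫_cone Σ_ε ∫ e^{−bF̂(a,ε,η)} gnoDensity dη` the sign sum `Σ_ε` over `2^{3+|Fol L|}` hemisphere patterns reduces to the FOUR flat patterns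
`(ε_x, ε_y) ∈ {±}²` with `ε_z = +`, followers `+` (✓`gnoDeficit_base_eq_zero`, this seat) plus uniformly large-field patterns:
* §1 quaternion bookkeeping: `su2Quat (c·C₁) = x̂·A·ẑ` and `su2Quat (C₀·c) = x̂·A` for the gnomonic leaders (`A = ν(axisPoint a)`, `x̂ = ν(±(1,η_x))`,
  `ẑ = ν(±(1,η_z))`; ✓`su2Quat_quatToSU2_slaveP_mul`), so the first σ-relation defect is `‖x̂·A·(ẑ − 1)‖ = ‖ẑ − 1‖` (`norm_sigmaRel_zero_quat`);
* §2 ★ `two_le_fd_sigmaRel_zero_of_zSign_false` — for `ε_z = false` the letter `ẑ` has negative real part, `‖ẑ − 1‖² = 2 − 2re ẑ ≥ 2`, hence the Frobenius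
  defect `‖c·C₁ − C₀·c‖_F ≥ 2` (✓`fd_sq_eq_two_mul`);
* §3 ★★★ `gnoDeficit_one_ge_of_zSign_false (ha : a ≠ 0) (ε) (hz : ε.2.1 = false) (η) : 1/(900·L⁶) ≤ gnoDeficit 0 1 a ε η` (✓`chartDeficit_ge_of_sigmaRel_far`
  with `R = 2`), and the Boltzmann form ★ `exp_neg_mul_gnoDeficit_le_of_zSign_false` (`e^{−bF̂} ≤ e^{−b/(900L⁶)}`, `b ≥ 0`).
So on the steep window the `2^{3+|Fol L|} − 4` non-flat sign patterns of the principal sector contribute `≤ 2^{6L⁴}·e^{−b/(900L⁶)} × (total mass)`.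

HONEST LABEL: bookkeeping on landed inequalities; ⟨24197⟩ (window-uniform) ∕ ⟨24194⟩ ∕ ⟨24497⟩ OPEN; own crux ⟨22884⟩ OPEN (blocked-on ⟨19935⟩); no crux, rung of
record or summit is proved; the Yang–Mills mass gap is NOT proved; no summit is proved by a line.  THEOREMS ONLY (0 `def`, 0 `sorry`), standard axioms.
Width seat ym-line-sfw-p2-w3 g66 (cell ym-idea-1, free hands), `--supports stmt-QuantumFields-24197`.  References: [cite: Luscher1983, §2]; [folklore].
-/

set_option autoImplicit false

noncomputable section

open MeasureTheory Quaternion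
open scoped BigOperators Quaternion
open Literature.MathematicalPhysics.QuantumFieldTheory hiding SU2
open Literature.MathematicalPhysics.QuantumLattice
open Literature.Analysis.Calculus (radialUnit radialUnit_def norm_radialUnit)
open Literature.MathematicalPhysics.QuantumFieldTheory.Balaban1983to89.T4ExpWindowSmallField (norm_sub_one_sq)
open Literature.MathematicalPhysics.QuantumFieldTheory.Balaban1983to89.T4WilsonGaugeFlatDirection (su2Quat_injective)

namespace Summit.QuantumFields.YangMills.Theorems.SwapVirialDeficit.BlowUpRing

open Summit.QuantumFields.YangMills.Theorems.FemtoTransferGap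
open Summit.QuantumFields.YangMills.Theorems.FemtoTransferGap.TT
open Summit.QuantumFields.YangMills.Theorems.FemtoTransferGap.TwoLattice.Flat (fd)
open Summit.QuantumFields.YangMills.Theorems.VirialFluxGap.RingDeficit
open Summit.QuantumFields.YangMills.Theorems.SwapVirialDeficit.SwapRing
open Summit.QuantumFields.YangMills.Theorems.SwapTwistDeficit.ToronLog (axisPoint)
open Summit.QuantumFields.YangMills.Theorems.SwapVirialDeficit.ZeroModeSigma (dil3 dilateIm slaveP slaveP_def norm_slaveP norm_axisUnit
  su2Quat_quatToSU2_eq_radialUnit)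
open Summit.QuantumFields.YangMills.Theorems.SwapVirialDeficit.BlowUp (leaderTuple leaderTuple_apply dil3_one' dilateIm_one_apply)
open Summit.QuantumFields.YangMills.Theorems.SwapVirialDeficit.Gnomonic (su2Quat_quatToSU2_slaveP_mul su2Quat_quatToSU2_axisUnit)
open Summit.QuantumFields.YangMills.Theorems.ToronValleyVolume.Lojasiewicz (fd_sq_eq_two_mul)

variable {L : ℕ} [NeZero L]

/-! ## §1 The first σ-relation of a gnomonic chart point, through `su2Quat` -/

omit [NeZero L] in
/-- `su2Quat (c · C₁) = x̂ · A · ẑ` for the gnomonic leaders (`c = ν(A)`, `C₁ = ν(Ā x̂ A ẑ)`, `A Ā = 1`). [folklore] -/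
theorem su2Quat_hub_mul_gnoLeader_one {a : ℍ} (ha : a ≠ 0) (ε : GnoSign L) (η : GnoCoord L) :
    su2Quat ((blowUpPoint (L := L) 1 (gnomonicPoint a ε η)).1 3 * (blowUpPoint (L := L) 1 (gnomonicPoint a ε η)).1 1) =
      radialUnit (gnoLetter ε.1.1 η.1.1) * radialUnit (axisPoint a) * radialUnit (gnoLetter ε.2.1 η.2.1) := by
  have hA1 : ‖radialUnit (axisPoint a)‖ = 1 := norm_axisUnit ha
  have hAA : radialUnit (axisPoint a) * star (radialUnit (axisPoint a)) = 1 := by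
    rw [Quaternion.self_mul_star, Quaternion.normSq_eq_norm_mul_self, hA1, mul_one, Quaternion.coe_one]
  have h3 : su2Quat ((blowUpPoint (L := L) 1 (gnomonicPoint a ε η)).1 3) = radialUnit (axisPoint a) := by
    show su2Quat (leaderTuple a (dil3 1 (gnomonicPoint a ε η).2.1) 3) = _
    rw [(leaderTuple_apply _ _).2.2.2]
    exact su2Quat_quatToSU2_axisUnit ha
  have h1 : su2Quat ((blowUpPoint (L := L) 1 (gnomonicPoint a ε η)).1 1) =
      star (radialUnit (axisPoint a)) * radialUnit (gnoLetter ε.1.1 η.1.1) * radialUnit (axisPoint a) * radialUnit (gnoLetter ε.2.1 η.2.1) := by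
    show su2Quat (leaderTuple a (dil3 1 (gnomonicPoint a ε η).2.1) 1) = _
    rw [(leaderTuple_apply _ _).2.1, dil3_one']
    show su2Quat (quatToSU2 (slaveP (radialUnit (axisPoint a)) (gnoLetter ε.1.1 η.1.1) * gnoLetter ε.2.1 η.2.1)) = _
    rw [su2Quat_quatToSU2_slaveP_mul hA1 (gnoLetter_ne_zero _ _) (gnoLetter_ne_zero _ _),
      su2Quat_quatToSU2_eq_radialUnit (gnoLetter_ne_zero _ _), su2Quat_quatToSU2_eq_radialUnit (gnoLetter_ne_zero _ _)]
  rw [Balaban1983to89.T4HaarSU2Translate.su2Quat_mul, h3, h1]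
  simp only [← mul_assoc]
  rw [hAA, one_mul]

omit [NeZero L] in
/-- `su2Quat (C₀ · c) = x̂ · A`. [folklore] -/
theorem su2Quat_gnoLeader_zero_mul_hub {a : ℍ} (ha : a ≠ 0) (ε : GnoSign L) (η : GnoCoord L) :
    su2Quat ((blowUpPoint (L := L) 1 (gnomonicPoint a ε η)).1 0 * (blowUpPoint (L := L) 1 (gnomonicPoint a ε η)).1 3) =
      radialUnit (gnoLetter ε.1.1 η.1.1) * radialUnit (axisPoint a) := by
  have h3 : su2Quat ((blowUpPoint (L := L) 1 (gnomonicPoint a ε η)).1 3) = radialUnit (axisPoint a) := by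
    show su2Quat (leaderTuple a (dil3 1 (gnomonicPoint a ε η).2.1) 3) = _
    rw [(leaderTuple_apply _ _).2.2.2]
    exact su2Quat_quatToSU2_axisUnit ha
  have h0 : su2Quat ((blowUpPoint (L := L) 1 (gnomonicPoint a ε η)).1 0) = radialUnit (gnoLetter ε.1.1 η.1.1) := by
    show su2Quat (leaderTuple a (dil3 1 (gnomonicPoint a ε η).2.1) 0) = _
    rw [(leaderTuple_apply _ _).1, dil3_one']
    exact su2Quat_quatToSU2_eq_radialUnit (gnoLetter_ne_zero _ _)
  rw [Balaban1983to89.T4HaarSU2Translate.su2Quat_mul, h3, h0]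

omit [NeZero L] in
/-- ★ **The first σ-relation defect in quaternions**: `‖su2Quat (c·C₁) − su2Quat (C₀·c)‖ = ‖ẑ − 1‖`, `ẑ = ν(gnoLetter ε_z η_z)` (the unit factors `x̂`, `A` drop out).
[folklore] -/
theorem norm_sigmaRel_zero_quat {a : ℍ} (ha : a ≠ 0) (ε : GnoSign L) (η : GnoCoord L) :
    ‖su2Quat ((blowUpPoint (L := L) 1 (gnomonicPoint a ε η)).1 3 * (blowUpPoint (L := L) 1 (gnomonicPoint a ε η)).1 1) -
        su2Quat ((blowUpPoint (L := L) 1 (gnomonicPoint a ε η)).1 0 * (blowUpPoint (L := L) 1 (gnomonicPoint a ε η)).1 3)‖ =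
      ‖radialUnit (gnoLetter ε.2.1 η.2.1) - 1‖ := by
  rw [su2Quat_hub_mul_gnoLeader_one ha, su2Quat_gnoLeader_zero_mul_hub ha, ← mul_sub_one, norm_mul, norm_mul,
    norm_radialUnit (gnoLetter_ne_zero _ _), norm_axisUnit ha, one_mul, one_mul]

/-! ## §2 The negative `z`-hemisphere: the defect is `≥ 2` -/

omit [NeZero L] in
/-- The negative-hemisphere letter `ν(−(1,v))` has negative real part. [folklore] -/
theorem re_radialUnit_gnoLetter_false_neg (v : Fin 3 → ℝ) : (radialUnit (gnoLetter false v)).re < 0 := by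
  have hne := gnoLetter_ne_zero false v
  have hn : 0 < ‖gnoLetter false v‖ := norm_pos_iff.2 hne
  have hre : (radialUnit (gnoLetter false v)).re = ‖gnoLetter false v‖⁻¹ * (gnoLetter false v).re := by
    rw [radialUnit_def, Quaternion.re_smul, smul_eq_mul]
  rw [hre, gnoLetter_re]
  have hs : gnoSign false = -1 := by simp [gnoSign]
  rw [hs]
  nlinarith [inv_pos.2 hn]

omit [NeZero L] in
/-- `‖ν(−(1,v)) − 1‖² ≥ 2`. [folklore] -/
theorem two_le_norm_radialUnit_gnoLetter_false_sub_one_sq (v : Fin 3 → ℝ) : 2 ≤ ‖radialUnit (gnoLetter false v) - 1‖ ^ 2 := by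
  rw [norm_sub_one_sq (norm_radialUnit (gnoLetter_ne_zero false v))]
  linarith [re_radialUnit_gnoLetter_false_neg v]

omit [NeZero L] in
/-- ★ **For `ε_z = false` the first σ-relation defect is `≥ 2` in Frobenius norm**: `2 ≤ ‖c·C₁ − C₀·c‖_F` at every gnomonic chart point. [cite: Luscher1983, §2] -/
theorem two_le_fd_sigmaRel_zero_of_zSign_false {a : ℍ} (ha : a ≠ 0) (ε : GnoSign L) (hz : ε.2.1 = false) (η : GnoCoord L) :
    2 ≤ frobNorm ((((blowUpPoint (L := L) 1 (gnomonicPoint a ε η)).1 (Fin.last 3) *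
        (blowUpPoint (L := L) 1 (gnomonicPoint a ε η)).1 (Fin.castSucc (Equiv.swap (0 : Fin 3) 1 0)) : SU2) : Matrix (Fin 2) (Fin 2) ℂ) -
        (((blowUpPoint (L := L) 1 (gnomonicPoint a ε η)).1 (Fin.castSucc 0) * (blowUpPoint (L := L) 1 (gnomonicPoint a ε η)).1 (Fin.last 3) : SU2) :
          Matrix (Fin 2) (Fin 2) ℂ)) := by
  set q := blowUpPoint (L := L) 1 (gnomonicPoint a ε η) with hq
  rw [Equiv.swap_apply_left]
  show 2 ≤ frobNorm (((q.1 3 * q.1 1 : SU2) : Matrix (Fin 2) (Fin 2) ℂ) - ((q.1 0 * q.1 3 : SU2) : Matrix (Fin 2) (Fin 2) ℂ))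
  have hfd : fd (q.1 3 * q.1 1) (q.1 0 * q.1 3) = frobNorm (((q.1 3 * q.1 1 : SU2) : Matrix (Fin 2) (Fin 2) ℂ) - ((q.1 0 * q.1 3 : SU2) : Matrix (Fin 2) (Fin 2) ℂ)) := by
    simp only [fd]
  rw [← hfd]
  have h1 : fd (q.1 3 * q.1 1) (q.1 0 * q.1 3) ^ 2 = 2 * ‖radialUnit (gnoLetter ε.2.1 η.2.1) - 1‖ ^ 2 := by
    rw [fd_sq_eq_two_mul, hq, norm_sigmaRel_zero_quat ha]
  rw [hz] at h1
  have h0 : 0 ≤ fd (q.1 3 * q.1 1) (q.1 0 * q.1 3) := frobNorm_nonneg _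
  have hsq : (2 : ℝ) ^ 2 ≤ fd (q.1 3 * q.1 1) (q.1 0 * q.1 3) ^ 2 := by
    rw [h1]; nlinarith [two_le_norm_radialUnit_gnoLetter_false_sub_one_sq (η.2.1)]
  exact (pow_le_pow_iff_left₀ (by norm_num) h0 two_ne_zero).1 hsq

/-! ## §3 Gnomonic level: the negative `z`-hemisphere is uniformly large field -/

/-- ★★★ **THE NEGATIVE `z`-HEMISPHERE IS LARGE FIELD** (principal sector): `ε_z = false ⟹ 1/(900·L⁶) ≤ gnoDeficit 0 1 a ε η` for every hub `a ≠ 0`, all other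
signs and ALL gnomonic coordinates `η` (✓`chartDeficit_ge_of_sigmaRel_far` with `R = 2`). [cite: Luscher1983, §2] -/
theorem gnoDeficit_one_ge_of_zSign_false {a : ℍ} (ha : a ≠ 0) (ε : GnoSign L) (hz : ε.2.1 = false) (η : GnoCoord L) :
    1 / (900 * (L : ℝ) ^ 6) ≤ gnoDeficit (fun _ => false) (fun _ => 1) a ε η := by
  unfold gnoDeficit
  have h := chartDeficit_ge_of_sigmaRel_far (L := L) (blowUpPoint (L := L) 1 (gnomonicPoint a ε η)) 0 (R := 2) (by norm_num)
    (two_le_fd_sigmaRel_zero_of_zSign_false ha ε hz η)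
  calc 1 / (900 * (L : ℝ) ^ 6) = 2 ^ 2 / (3600 * (L : ℝ) ^ 6) := by ring
    _ ≤ _ := h

/-- ★ **The Boltzmann factor of a negative-`z` pattern**: `e^{−b·F̂} ≤ e^{−b/(900·L⁶)}` for `b ≥ 0`. [cite: Luscher1983, §2] -/
theorem exp_neg_mul_gnoDeficit_le_of_zSign_false {a : ℍ} (ha : a ≠ 0) (ε : GnoSign L) (hz : ε.2.1 = false) (η : GnoCoord L) {b : ℝ} (hb : 0 ≤ b) :
    Real.exp (-(b * gnoDeficit (fun _ => false) (fun _ => 1) a ε η)) ≤ Real.exp (-(b / (900 * (L : ℝ) ^ 6))) := by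
  have h := gnoDeficit_one_ge_of_zSign_false (L := L) ha ε hz η
  rw [Real.exp_le_exp, neg_le_neg_iff]
  calc b / (900 * (L : ℝ) ^ 6) = b * (1 / (900 * (L : ℝ) ^ 6)) := by ring
    _ ≤ _ := mul_le_mul_of_nonneg_left h hb

/-- ★★ **THE SIGN SUM REDUCES TO THE FOUR FLAT LEADER PATTERNS PLUS LARGE FIELD** (principal sector): a pattern `ε` is either FLAT-TYPE (`ε_z = +` and all follower
signs `+`; then the base is exactly flat, ✓`gnoDeficit_base_eq_zero`) or LARGE FIELD: `min (1/(900L⁶)) (1/(576L⁶)) = 1/(900L⁶) ≤ F̂(a,ε,η)` for all `η`. [cite: Luscher1983, §2] -/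
theorem gnoDeficit_one_ge_of_not_flatPattern {a : ℍ} (ha : a ≠ 0) (ε : GnoSign L) (h : ¬ (ε.2.1 = true ∧ ε.2.2 = fun _ => true)) (η : GnoCoord L) :
    1 / (900 * (L : ℝ) ^ 6) ≤ gnoDeficit (fun _ => false) (fun _ => 1) a ε η := by
  by_cases hz : ε.2.1 = true
  · have hF : ¬ (ε.2.2 = fun _ => true) := fun hF => h ⟨hz, hF⟩
    obtain ⟨i, hi⟩ : ∃ i, ε.2.2 i = false := by
      by_contra hne
      exact hF (funext fun i => by
        cases hi : ε.2.2 i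
        · exact absurd ⟨i, hi⟩ hne
        · rfl)
    have hL : (0 : ℝ) < L := by exact_mod_cast NeZero.pos L
    calc 1 / (900 * (L : ℝ) ^ 6) ≤ 1 / (576 * (L : ℝ) ^ 6) := by
          apply one_div_le_one_div_of_le (by positivity); nlinarith [pow_pos hL 6]
      _ ≤ _ := gnoDeficit_one_ge_of_follower_sign_false a ε η hi
  · exact gnoDeficit_one_ge_of_zSign_false ha ε (by simpa using hz) η

/-! ## §4 (appended 2026-08-31, same seat) The packaged form of fcl-p3 g47's skeleton stub S1 `stub_badSign_floor` -/

/-- ★★ **STUB S1 OF THE SECTOR-000 SKELETON, LITERALLY** (`GoodSign ε := ε.2.1 = true ∧ ε.2.2 = fun _ => true`, `z₀ := fun _ => false` unfolded): one absolute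
constant `c = 1/900` such that for every `L`, every hub `a ≠ 0`, every sign pattern that is NOT good and every `η`, `c/L⁶ ≤ gnoDeficit 0 1 a ε η`.
[cite: Luscher1983, §2] -/
theorem badSign_floor : ∃ c : ℝ, 0 < c ∧ ∀ (L : ℕ) [NeZero L] (a : ℍ), a ≠ 0 → ∀ ε : GnoSign L, ¬ (ε.2.1 = true ∧ ε.2.2 = fun _ => true) →
    ∀ η : GnoCoord L, c / (L : ℝ) ^ 6 ≤ gnoDeficit (fun _ => false) (fun _ => 1) a ε η := by
  refine ⟨1 / 900, by norm_num, fun L _ a ha ε hε η => ?_⟩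
  have h := gnoDeficit_one_ge_of_not_flatPattern (L := L) ha ε hε η
  calc 1 / 900 / (L : ℝ) ^ 6 = 1 / (900 * (L : ℝ) ^ 6) := by ring
    _ ≤ _ := h

end Summit.QuantumFields.YangMills.Theorems.SwapVirialDeficit.BlowUpRing

end
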